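import Summits.MatrixMultiplication.OmegaCensus.STPPVosperSlackFourCell22TableP2
import Summits.MatrixMultiplication.OmegaCensus.STPPVosperTilingWordsPrunedQ
import Summits.MatrixMultiplication.OmegaCensus.STPPVosperSlackTwoLawABQ

/-!
# ω-census (abelian STPP census): cell (2,2) of the slack-4 law (fifth ℤ₆₁ leaf) — dead-table rows for `tbl22`, part 27 of 29 (kernel computations)

HONEST FRAMING (pub-omega census; verbatim): lottery ticket; floor = certified bounds/negative ranges.
Census STRUCTURE (seat pub-omega-stpp-2 gen 28, 2026-08-29), family (b2).  For each entry `e = (Yo, Zo)` of the cell-(2,2) dead table `tbl22`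
(`STPPVosperSlackFourCell22TableP1/P2.lean`, 694 entries) the words-cover search of the two other blocks (3,3,3), (2,2,2) over the pruned enumerator
`blockDiffsWQ` (direct orientation; python mirror verdict: all 694 dead direct) returns `false`, so the entry is `CoverDead` (`coverDead_forall_of_rows`).
Each theorem is ONE `decide +kernel` over a range of table entries.  Assembly in `STPPVosperSlackFourCell22TblRowsAsm.lean`.  Nothing here is progress on `ω`.
-/

namespace Summit.MatrixMultiplication.OmegaCensus.CubeNB.S2

open Summit.MatrixMultiplication.OmegaCensus.CubeNB

/-- Dead-table entries `[624, 628)` of `tbl22`: the words-cover search fails. [folklore] -/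
theorem dead22_c156 : ∀ e ∈ (tbl22.drop 624).take 4, existsCoverW 61 e.1 e.2 [blockDiffsWQ 61 e.1 e.2 3 3 3, blockDiffsWQ 61 e.1 e.2 2 2 2] [] [] [] = false := by
  decide +kernel

/-- Dead-table entries `[628, 632)` of `tbl22`: the words-cover search fails. [folklore] -/
theorem dead22_c157 : ∀ e ∈ (tbl22.drop 628).take 4, existsCoverW 61 e.1 e.2 [blockDiffsWQ 61 e.1 e.2 3 3 3, blockDiffsWQ 61 e.1 e.2 2 2 2] [] [] [] = false := by
  decide +kernel

/-- Dead-table entries `[632, 636)` of `tbl22`: the words-cover search fails. [folklore] -/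
theorem dead22_c158 : ∀ e ∈ (tbl22.drop 632).take 4, existsCoverW 61 e.1 e.2 [blockDiffsWQ 61 e.1 e.2 3 3 3, blockDiffsWQ 61 e.1 e.2 2 2 2] [] [] [] = false := by
  decide +kernel

/-- Dead-table entries `[636, 640)` of `tbl22`: the words-cover search fails. [folklore] -/
theorem dead22_c159 : ∀ e ∈ (tbl22.drop 636).take 4, existsCoverW 61 e.1 e.2 [blockDiffsWQ 61 e.1 e.2 3 3 3, blockDiffsWQ 61 e.1 e.2 2 2 2] [] [] [] = false := by
  decide +kernel

/-- Dead-table entries `[640, 644)` of `tbl22`: the words-cover search fails. [folklore] -/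
theorem dead22_c160 : ∀ e ∈ (tbl22.drop 640).take 4, existsCoverW 61 e.1 e.2 [blockDiffsWQ 61 e.1 e.2 3 3 3, blockDiffsWQ 61 e.1 e.2 2 2 2] [] [] [] = false := by
  decide +kernel

/-- Dead-table entries `[644, 648)` of `tbl22`: the words-cover search fails. [folklore] -/
theorem dead22_c161 : ∀ e ∈ (tbl22.drop 644).take 4, existsCoverW 61 e.1 e.2 [blockDiffsWQ 61 e.1 e.2 3 3 3, blockDiffsWQ 61 e.1 e.2 2 2 2] [] [] [] = false := by
  decide +kernel

end Summit.MatrixMultiplication.OmegaCensus.CubeNB.S2
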